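import Summits.QuantumAdvantage.QuantumAdvantage.Theorems.CubicForrelationNearExactIsExactWalshTower
import Summits.QuantumAdvantage.QuantumAdvantage.Theorems.CubicForrelationNearExactIsExactLevelCapacity
import Summits.QuantumAdvantage.QuantumAdvantage.Theorems.CubicForrelationNearExactIsExactLevelBent
import Summits.QuantumAdvantage.QuantumAdvantage.Theorems.CubicForrelationNearExactIsExactHouCubic
import Summits.QuantumAdvantage.QuantumAdvantage.Theorems.CubicForrelationNearExactIsExactAxParity
import Summits.QuantumAdvantage.QuantumAdvantage.Theorems.CubicForrelationNearExactIsExactValueGranularity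
import Summits.QuantumAdvantage.QuantumAdvantage.Theorems.SignedCubicForrelationNotPrBPP.Negative.HalfQuadMachine

/-!
# Crux `CubicForrelation.NearExactIsExact` (stmt-QuantumAdvantage-14043) — certified isolation on `n ≤ 16` bits,
  and `θ = 7/8` on `n = 8`, WITHOUT computation: the 2-adic Walsh tower assembled

Line `direct-sum-amplification`, lead c6 (§4f of `Cruxes/NearExactIsExact/Lines/direct_sum_amplification.lean`),
answering the CERTIFICATE OBJECTIVE (human, 2026-08-16/17: "certified check of near-exact ⇒ exact on the finite families
in scope, `θ = 7/8` first; a Lean-checkable certificate rather than more asymptotics").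

THE TOWER. For a CUBIC `g` on `n` bits every Walsh value `W_g(x) = Σ_y (−1)^{g(y)} (−1)^{y·x}` is a multiple of
`2^{⌈n/3⌉}` (Ax/McEliece: the landed `vg_W_granular` fed with the landed `stub_axParity`). IF `2^j ∣ W_g(x)` for EVERY `x`,
write `W_g = 2^j u`; then the parity `x ↦ [u(x) odd]` is a Boolean function of algebraic degree `≤ d` whenever
`j + 1 ≤ k + ⌈(n−k)/3⌉` for all `d < k ≤ n` (the landed T = `stub_walshTower`: Poisson over a coordinate cube, Ax on the
complementary cube, Möbius). A level `j < m` (`n = m + m`) whose parity is non-zero COSTS capacity,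
`Σ_x |W_g(x)| ≤ 2^{3m}(1 − 2^{−d−1} 4^{j−m})` (the landed LCap = `stub_levelCapacity`), and at the bent level `j = m` either
`g` is bent or `Σ_x |W_g(x)| ≤ 2^{3m}(1 − 2^{−d−1})` (the landed LB2 = `stub_levelBent`); capacity bounds forrelation,
`Φ(f,g) · 2^{3m} ≤ Σ_x |W_g(x)|` for EVERY `f` (`tw_forrelation_le_cap`), and a bent cubic `g` has a dual of degree
`≤ ⌊(m+3)/2⌋` (the landed HOU = `stub_houCubic`), so the cubic pair is exact or `Φ ≤ 1 − 2^{1−⌊(m+3)/2⌋}`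
(`bb_band_of_dual_degree`, Reed–Muller distance).

WALKING DOWN THE TOWER gives, by pure counting, an isolation constant for each small `n`:
* `isolation_eight`: **for all cubic `f, g : 𝔽₂⁸ → 𝔽₂`, `Φ(f,g) > 7/8 ⇒ Φ(f,g) = 1`** — `7/8` is the constant conjectured
  sharp in the crux text of 2026-08-16 (since REFUTED as a global constant: `Φ = 15/16` at `n = 16`,
  `Negative/FifteenSixteenths.lean`; at `n = 10` the value `7/8` is attained, `forrelation_fT_gT`, and isolation above `7/8`
  is a THEOREM: `isolation_ten_78`, …TenIsolation78Final.lean, 2026-08-18 — CENSUS₁₀′ discharged by proof), TIGHT at `n = 8` in the sense that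
  non-bent cubics on 8 bits reach Walsh capacity exactly `7/8` (`capacity_eight`:
  `Σ|W_g| ≤ 3584 = (7/8)·2¹²` for every non-bent cubic `g` — the certified-compute seat's EXHAUSTIVE `n = 8` scan over
  `32 × 2²⁸` cubics mod affine terms, kit j018712, is now a theorem with a one-page proof);
* `isolation_ten`: `n = 10` at `15/16`; `isolation_twelve`: `n = 12` at `31/32`; `isolation_fourteen`: `n = 14` at
  `31/32`; `isolation_sixteen`: `n = 16` at `63/64` (the landed `15/16` witness `Negative.forrelation_f16_g16` lives at
  `n = 16`);
* `split_ten` / `split_ten_both`: what the tower leaves at `n = 10` and `θ = 7/8` — a cubic pair on 10 bits with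
  `7/8 < Φ < 1` must be SPLIT on both sides (Walsh spectrum `≡ 16 (mod 32)` exactly on an affine hyperplane), the certified
  search space for the next finite check.
The companion (computational) file `…IsolationFromTen.lean` combines `isolation_eight` with the certified-compute seat's
`nearExact78_le_six` (native_decide checker, `n ≤ 6`): isolation at `7/8` for every even `n ≤ 8`, hence
`NearExactIsExact ⇔` its restriction to `n ≥ 10`, and `63/64` for every even `n ≤ 16`.

Sources: J. Ax (1964) / R. McEliece (1972) divisibility (Carlet 2021 §4.1); O. S. Rothaus, JCTA 20 (1976); X.-D. Hou,
Discrete Math. 189 (1998) (cubic bent duals); C. Carlet, *Boolean Functions for Cryptography and Coding Theory*, CUP 2021,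
§2.2, Thm 7, Thm 13, Prop. 74; S. Aaronson, A. Ambainis, *Forrelation*, SIAM J. Comput. 47 (2018) §1.1.1. Everything below is
proved from Mathlib and the tree; axioms are the standard three (no `native_decide` anywhere in this file's closure).
-/

set_option linter.dupNamespace false -- D-0017: single-problem summit ⇒ `QuantumAdvantage.QuantumAdvantage` by design

noncomputable section

namespace Summit.QuantumAdvantage.QuantumAdvantage.Theorems.CubicForrelation.NearExactIsExact

open Finset
open Literature.Computability.QuantumComplexity
open Literature.Computability.QuantumComplexity.DerivativeWalsh (W)
open Summit.QuantumAdvantage.QuantumAdvantage.Theorems.SignedCubicForrelationNotPrBPP.Negative.HalfQuad (forrelation_comm)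

variable {n : ℕ}

/-! ### Glue: capacity bounds forrelation, the Ax base, one level up, the bent endgame -/

/-- Capacity bounds forrelation: `Φ(f,g) · 2^{3m} ≤ Σ_x |W_g(x)|` for EVERY Boolean `f` (`2^{3m} Φ = Σ_x (−1)^{f(x)} W_g(x)`).
[folklore] -/
theorem tw_forrelation_le_cap {m : ℕ} (f g : (Fin (m + m) → Bool) → Bool) :
    forrelation f g * (2 : ℝ) ^ (3 * m) ≤ ∑ x, |W (fun y => signOf (g y)) x| := by
  rw [mul_comm, vg_two_pow_mul_forrelation]
  refine sum_le_sum fun x _ => ?_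
  have h1 : |signOf (f x)| = 1 := by unfold signOf; split_ifs <;> simp
  calc signOf (f x) * W (fun y => signOf (g y)) x ≤ |signOf (f x) * W (fun y => signOf (g y)) x| := le_abs_self _
    _ = |W (fun y => signOf (g y)) x| := by rw [abs_mul, h1, one_mul]

/-- A capacity bound `Σ|W_g| ≤ 2^{3m}·c` caps the forrelation against every `f`: `Φ(f,g) ≤ c`. [folklore] -/
theorem tw_forrelation_le_of_cap {m : ℕ} (f g : (Fin (m + m) → Bool) → Bool) {c : ℝ}
    (h : ∑ x, |W (fun y => signOf (g y)) x| ≤ (2 : ℝ) ^ (3 * m) * c) : forrelation f g ≤ c := by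
  have hcap := tw_forrelation_le_cap f g
  have hpos : (0 : ℝ) < (2 : ℝ) ^ (3 * m) := by positivity
  nlinarith

/-- One level up the tower: if every `u(x)` is even then `W_g = 2^{j+1} · (u/2)`. [folklore] -/
theorem tw_level_up {j : ℕ} (g : (Fin n → Bool) → Bool) (u : (Fin n → Bool) → ℤ)
    (hu : ∀ x, W (fun y => signOf (g y)) x = (2 : ℝ) ^ j * (u x : ℝ)) (hev : ∀ x, ¬ Odd (u x)) :
    ∀ x, W (fun y => signOf (g y)) x = (2 : ℝ) ^ (j + 1) * ((u x / 2 : ℤ) : ℝ) := by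
  intro x
  have he : u x = 2 * (u x / 2) := by
    have h2 : (2 : ℤ) ∣ u x := even_iff_two_dvd.1 (Int.not_odd_iff_even.1 (hev x))
    exact (Int.mul_ediv_cancel' h2).symm
  rw [hu x, pow_succ]
  conv_lhs => rw [he]
  push_cast
  ring

/-- The Ax BASE of the tower (McEliece divisibility, the landed `vg_W_granular` + `stub_axParity`): for cubic `g` on `n`
bits, `W_g = 2^{⌈n/3⌉} · u` with `u` integer-valued (`⌈n/3⌉ = (n+2)/3`, supplied as `j₀`). -/
theorem tw_base (g : (Fin n → Bool) → Bool) (hg : IsDegLeFun 3 g) (j₀ : ℕ) (hj₀ : (n + 2) / 3 = j₀) :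
    ∃ u : (Fin n → Bool) → ℤ, ∀ x, W (fun y => signOf (g y)) x = (2 : ℝ) ^ j₀ * (u x : ℝ) := by
  choose u hu using fun x => vg_W_granular stub_axParity g hg x
  exact ⟨u, fun x => by rw [hu x, hj₀]⟩

/-- One step DOWN the tower at a level `j < m` (T + LCap): either the level costs capacity
`Σ|W_g| ≤ 2^{3m}(1 − 2^{−d−1}4^{j−m})` (its parity is non-zero, of degree `≤ d` by T under the arithmetic side condition), or
every `u` is even and `W_g = 2^{j+1}·u'`. -/
theorem tw_step {m j d : ℕ} (g : (Fin (m + m) → Bool) → Bool) (u : (Fin (m + m) → Bool) → ℤ) (hg : IsDegLeFun 3 g)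
    (hj : j < m) (hu : ∀ x, W (fun y => signOf (g y)) x = (2 : ℝ) ^ j * (u x : ℝ))
    (hside : ∀ k, d < k → k ≤ m + m → j + 1 ≤ k + (m + m - k + 2) / 3) :
    ∑ x, |W (fun y => signOf (g y)) x| ≤ (2 : ℝ) ^ (3 * m) * (1 - (1 / 2) ^ (d + 1) * (1 / 4) ^ (m - j)) ∨
      ∃ u' : (Fin (m + m) → Bool) → ℤ, ∀ x, W (fun y => signOf (g y)) x = (2 : ℝ) ^ (j + 1) * (u' x : ℝ) := by
  by_cases hodd : ∃ x, Odd (u x)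
  · exact Or.inl (stub_levelCapacity m j d g u hj hu (stub_walshTower stub_axParity (m + m) j d g u hg hu hside) hodd)
  · push Not at hodd
    exact Or.inr ⟨fun x => u x / 2, tw_level_up g u hu hodd⟩

/-- The TOP of the tower at the bent level `j = m` (T + LB2): `g` is bent, or the level costs capacity
`Σ|W_g| ≤ 2^{3m}(1 − 2^{−d−1})` with the degree `d` supplied by T. -/
theorem tw_top {m d : ℕ} (g : (Fin (m + m) → Bool) → Bool) (u : (Fin (m + m) → Bool) → ℤ) (hg : IsDegLeFun 3 g)
    (hu : ∀ x, W (fun y => signOf (g y)) x = (2 : ℝ) ^ m * (u x : ℝ))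
    (hside : ∀ k, d < k → k ≤ m + m → m + 1 ≤ k + (m + m - k + 2) / 3) :
    (∀ x, W (fun y => signOf (g y)) x ^ 2 = (2 : ℝ) ^ (m + m)) ∨
      ∑ x, |W (fun y => signOf (g y)) x| ≤ (2 : ℝ) ^ (3 * m) * (1 - (1 / 2) ^ (d + 1)) :=
  stub_levelBent m d g u hu (stub_walshTower stub_axParity (m + m) m d g u hg hu hside)

/-- The bent ENDGAME (HOU + R): a cubic pair with `g` bent on `m + m ≥ 6` bits has `Φ = 1` or `Φ ≤ 1 − 2/2^{⌊(m+3)/2⌋}`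
(the dual has degree `≤ ⌊(m+3)/2⌋` by Hou's bound, and so does the cubic `f`; Reed–Muller distance). -/
theorem tw_bent_end {m : ℕ} (hm : 3 ≤ m) (f g : (Fin (m + m) → Bool) → Bool) (hf : IsDegLeFun 3 f) (hg : IsDegLeFun 3 g)
    (hbent : ∀ x, W (fun y => signOf (g y)) x ^ 2 = (2 : ℝ) ^ (m + m)) :
    forrelation f g = 1 ∨ forrelation f g ≤ 1 - 2 / 2 ^ ((m + 3) / 2) := by
  obtain ⟨d, hd⟩ := bb_exists_dual hbent
  exact bb_band_of_dual_degree bb_rmWeight_holds m ((m + 3) / 2) f g d (hf.mono (by omega))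
    (stub_houCubic stub_axParity m g d hg hd) hd

/-! ### The certified finite-`n` isolation theorems -/

/-- **Isolation at `7/8` on `8` bits.** For all cubic `f, g : 𝔽₂⁸ → 𝔽₂`, `Φ(f,g) > 7/8 ⇒ Φ(f,g) = 1` — TIGHT at `n = 8`
as a capacity statement (`capacity_eight`).  (`7/8` was the crux text's conjectured global constant; that is refuted by
`Φ = 15/16` at `n = 16`, `Negative/FifteenSixteenths.lean`; at `n = 10` isolation above `7/8` is the theorem `isolation_ten_78`.)
Level 3 (Ax base): parity of degree `≤ 0`, cost `7/8`; level 4: parity of degree `≤ 2`: bent (then the dual is cubic by Hou and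
`Φ = 1 ∨ Φ ≤ 3/4`) or cost `7/8`. -/
theorem isolation_eight :
    ∀ f g : (Fin (4 + 4) → Bool) → Bool, IsDegLeFun 3 f → IsDegLeFun 3 g →
      7 / 8 < forrelation f g → forrelation f g = 1 := by
  intro f g hf hg hΦ
  obtain ⟨u₃, hu₃⟩ := tw_base g hg 3 (by norm_num)
  rcases tw_step (j := 3) (d := 0) g u₃ hg (by norm_num) hu₃ (by intro k hk hkn; omega) with hcap | ⟨u₄, hu₄⟩
  · exfalso; have := tw_forrelation_le_of_cap f g hcap; norm_num at this; linarith
  rcases tw_top (d := 2) g u₄ hg hu₄ (by intro k hk hkn; omega) with hbent | hcap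
  · rcases tw_bent_end (by norm_num) f g hf hg hbent with h | h
    · exact h
    · exfalso; norm_num at h; linarith
  · exfalso; have := tw_forrelation_le_of_cap f g hcap; norm_num at this; linarith

/-- **Isolation at `15/16` on `10` bits.** For all cubic `f, g : 𝔽₂¹⁰ → 𝔽₂`, `Φ(f,g) > 15/16 ⇒ Φ(f,g) = 1`. Level 4: parity
affine, cost `15/16`; level 5: parity quadratic: bent (dual of degree `≤ 4`, `Φ = 1 ∨ Φ ≤ 7/8`) or cost `7/8`. (At `7/8`
the tower leaves one configuration open at `n = 10`: level-4 parity a NON-CONSTANT affine function.) -/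
theorem isolation_ten :
    ∀ f g : (Fin (5 + 5) → Bool) → Bool, IsDegLeFun 3 f → IsDegLeFun 3 g →
      15 / 16 < forrelation f g → forrelation f g = 1 := by
  intro f g hf hg hΦ
  obtain ⟨u₄, hu₄⟩ := tw_base g hg 4 (by norm_num)
  rcases tw_step (j := 4) (d := 1) g u₄ hg (by norm_num) hu₄ (by intro k hk hkn; omega) with hcap | ⟨u₅, hu₅⟩
  · exfalso; have := tw_forrelation_le_of_cap f g hcap; norm_num at this; linarith
  rcases tw_top (d := 2) g u₅ hg hu₅ (by intro k hk hkn; omega) with hbent | hcap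
  · rcases tw_bent_end (by norm_num) f g hf hg hbent with h | h
    · exact h
    · exfalso; norm_num at h; linarith
  · exfalso; have := tw_forrelation_le_of_cap f g hcap; norm_num at this; linarith

/-- **Isolation at `31/32` on `12` bits.** For all cubic `f, g : 𝔽₂¹² → 𝔽₂`, `Φ(f,g) > 31/32 ⇒ Φ(f,g) = 1`. Level 4: parity
constant, cost `31/32`; level 5: affine, cost `15/16`; level 6: cubic: bent (dual `≤ 4`, `Φ = 1 ∨ Φ ≤ 7/8`) or cost `15/16`. -/
theorem isolation_twelve :
    ∀ f g : (Fin (6 + 6) → Bool) → Bool, IsDegLeFun 3 f → IsDegLeFun 3 g →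
      31 / 32 < forrelation f g → forrelation f g = 1 := by
  intro f g hf hg hΦ
  obtain ⟨u₄, hu₄⟩ := tw_base g hg 4 (by norm_num)
  rcases tw_step (j := 4) (d := 0) g u₄ hg (by norm_num) hu₄ (by intro k hk hkn; omega) with hcap | ⟨u₅, hu₅⟩
  · exfalso; have := tw_forrelation_le_of_cap f g hcap; norm_num at this; linarith
  rcases tw_step (j := 5) (d := 1) g u₅ hg (by norm_num) hu₅ (by intro k hk hkn; omega) with hcap | ⟨u₆, hu₆⟩
  · exfalso; have := tw_forrelation_le_of_cap f g hcap; norm_num at this; linarith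
  rcases tw_top (d := 3) g u₆ hg hu₆ (by intro k hk hkn; omega) with hbent | hcap
  · rcases tw_bent_end (by norm_num) f g hf hg hbent with h | h
    · exact h
    · exfalso; norm_num at h; linarith
  · exfalso; have := tw_forrelation_le_of_cap f g hcap; norm_num at this; linarith

/-- **Isolation at `31/32` on `14` bits.** For all cubic `f, g : 𝔽₂¹⁴ → 𝔽₂`, `Φ(f,g) > 31/32 ⇒ Φ(f,g) = 1`. Level 5:
constant, cost `31/32`; level 6: quadratic, cost `31/32`; level 7: cubic: bent (dual `≤ 5`, `Φ = 1 ∨ Φ ≤ 15/16`) or cost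
`15/16`. -/
theorem isolation_fourteen :
    ∀ f g : (Fin (7 + 7) → Bool) → Bool, IsDegLeFun 3 f → IsDegLeFun 3 g →
      31 / 32 < forrelation f g → forrelation f g = 1 := by
  intro f g hf hg hΦ
  obtain ⟨u₅, hu₅⟩ := tw_base g hg 5 (by norm_num)
  rcases tw_step (j := 5) (d := 0) g u₅ hg (by norm_num) hu₅ (by intro k hk hkn; omega) with hcap | ⟨u₆, hu₆⟩
  · exfalso; have := tw_forrelation_le_of_cap f g hcap; norm_num at this; linarith
  rcases tw_step (j := 6) (d := 2) g u₆ hg (by norm_num) hu₆ (by intro k hk hkn; omega) with hcap | ⟨u₇, hu₇⟩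
  · exfalso; have := tw_forrelation_le_of_cap f g hcap; norm_num at this; linarith
  rcases tw_top (d := 3) g u₇ hg hu₇ (by intro k hk hkn; omega) with hbent | hcap
  · rcases tw_bent_end (by norm_num) f g hf hg hbent with h | h
    · exact h
    · exfalso; norm_num at h; linarith
  · exfalso; have := tw_forrelation_le_of_cap f g hcap; norm_num at this; linarith

/-- **Isolation at `63/64` on `16` bits.** For all cubic `f, g : 𝔽₂¹⁶ → 𝔽₂`, `Φ(f,g) > 63/64 ⇒ Φ(f,g) = 1` (the landed
`15/16` witness `Negative.forrelation_f16_g16` lives at `n = 16`). Level 6: affine, cost `63/64`; level 7: quadratic, cost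
`31/32`; level 8: quartic: bent (dual `≤ 5`, `Φ = 1 ∨ Φ ≤ 15/16`) or cost `31/32`. -/
theorem isolation_sixteen :
    ∀ f g : (Fin (8 + 8) → Bool) → Bool, IsDegLeFun 3 f → IsDegLeFun 3 g →
      63 / 64 < forrelation f g → forrelation f g = 1 := by
  intro f g hf hg hΦ
  obtain ⟨u₆, hu₆⟩ := tw_base g hg 6 (by norm_num)
  rcases tw_step (j := 6) (d := 1) g u₆ hg (by norm_num) hu₆ (by intro k hk hkn; omega) with hcap | ⟨u₇, hu₇⟩
  · exfalso; have := tw_forrelation_le_of_cap f g hcap; norm_num at this; linarith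
  rcases tw_step (j := 7) (d := 2) g u₇ hg (by norm_num) hu₇ (by intro k hk hkn; omega) with hcap | ⟨u₈, hu₈⟩
  · exfalso; have := tw_forrelation_le_of_cap f g hcap; norm_num at this; linarith
  rcases tw_top (d := 4) g u₈ hg hu₈ (by intro k hk hkn; omega) with hbent | hcap
  · rcases tw_bent_end (by norm_num) f g hf hg hbent with h | h
    · exact h
    · exfalso; norm_num at h; linarith
  · exfalso; have := tw_forrelation_le_of_cap f g hcap; norm_num at this; linarith

/-- **Non-bent cubics on `8` bits have Walsh capacity at most `7/8`**: for cubic `g : 𝔽₂⁸ → 𝔽₂` that is not bent,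
`Σ_x |W_g(x)| ≤ 3584 = (7/8)·2¹²`. This is the certified-compute seat's EXHAUSTIVE `n = 8` scan (kit j018712: maximum
`3584` over all `32 × 2²⁸` cubics mod affine terms, attained) as a THEOREM: level 3 costs `7/8`, level 4 is bent-or-`7/8`. -/
theorem capacity_eight :
    ∀ g : (Fin (4 + 4) → Bool) → Bool, IsDegLeFun 3 g →
      ¬ (∀ x, W (fun y => signOf (g y)) x ^ 2 = (2 : ℝ) ^ (4 + 4)) →
      ∑ x, |W (fun y => signOf (g y)) x| ≤ 3584 := by
  intro g hg hnb
  obtain ⟨u₃, hu₃⟩ := tw_base g hg 3 (by norm_num)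
  rcases tw_step (j := 3) (d := 0) g u₃ hg (by norm_num) hu₃ (by intro k hk hkn; omega) with hcap | ⟨u₄, hu₄⟩
  · norm_num at hcap; exact hcap
  rcases tw_top (d := 2) g u₄ hg hu₄ (by intro k hk hkn; omega) with hbent | hcap
  · exact absurd hbent hnb
  · norm_num at hcap; exact hcap

/-! ### What the tower leaves at `n = 10` and `θ = 7/8`: the SPLIT configuration -/

/-- **The split configuration at `n = 10`.** If cubic `f, g : 𝔽₂¹⁰ → 𝔽₂` have `7/8 < Φ(f,g) < 1`, then `W_g = 16·u` with the
level-4 parity `x ↦ [u(x) odd]` an affine Boolean function that is NEITHER identically false NOR identically true: `W_g` is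
`≡ 16 (mod 32)` exactly on an affine hyperplane and `≡ 0 (mod 32)` off it.  (Parity `≡ 0`: the bent level gives `Φ = 1` or
`Φ ≤ 7/8`; parity `≡ 1`: the level costs `7/8` with `d = 0`.)  This is the ONLY configuration in which a cubic pair on 10
bits could have a value in `(7/8, 1)` — the certified search space for the next finite check. -/
theorem split_ten :
    ∀ f g : (Fin (5 + 5) → Bool) → Bool, IsDegLeFun 3 f → IsDegLeFun 3 g →
      7 / 8 < forrelation f g → forrelation f g < 1 →
      ∃ u : (Fin (5 + 5) → Bool) → ℤ, (∀ x, W (fun y => signOf (g y)) x = (2 : ℝ) ^ 4 * (u x : ℝ)) ∧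
        IsDegLeFun 1 (fun x => decide (Odd (u x))) ∧ (∃ x, Odd (u x)) ∧ (∃ x, ¬ Odd (u x)) := by
  intro f g hf hg hΦ hΦ1
  obtain ⟨u₄, hu₄⟩ := tw_base g hg 4 (by norm_num)
  have hP : IsDegLeFun 1 (fun x => decide (Odd (u₄ x))) :=
    stub_walshTower stub_axParity (5 + 5) 4 1 g u₄ hg hu₄ (by intro k hk hkn; omega)
  refine ⟨u₄, hu₄, hP, ?_, ?_⟩
  · by_contra hno
    push Not at hno
    rcases tw_top (d := 2) g (fun x => u₄ x / 2) hg (tw_level_up g u₄ hu₄ hno) (by intro k hk hkn; omega)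
      with hbent | hcap
    · rcases tw_bent_end (by norm_num) f g hf hg hbent with h | h
      · exact absurd h (ne_of_lt hΦ1)
      · norm_num at h; linarith
    · have := tw_forrelation_le_of_cap f g hcap; norm_num at this; linarith
  · by_contra hall
    push Not at hall
    have hP0 : IsDegLeFun 0 (fun x => decide (Odd (u₄ x))) := by
      have : (fun x => decide (Odd (u₄ x))) = fun _ : Fin (5 + 5) → Bool => true :=
        funext fun x => decide_eq_true (hall x)
      rw [this]
      exact isDegLeFun_const 0 true
    obtain ⟨x₀⟩ : Nonempty (Fin (5 + 5) → Bool) := inferInstance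
    have hcap := stub_levelCapacity 5 4 0 g u₄ (by norm_num) hu₄ hP0 ⟨x₀, hall x₀⟩
    have := tw_forrelation_le_of_cap f g hcap; norm_num at this; linarith

/-- **Both sides split.** By the symmetry `Φ(f,g) = Φ(g,f)`, a cubic pair on 10 bits with `7/8 < Φ < 1` is split on BOTH
sides: the Walsh spectra of `f` and of `g` are each `≡ 16 (mod 32)` exactly on an affine hyperplane. -/
theorem split_ten_both :
    ∀ f g : (Fin (5 + 5) → Bool) → Bool, IsDegLeFun 3 f → IsDegLeFun 3 g →
      7 / 8 < forrelation f g → forrelation f g < 1 →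
      (∃ u : (Fin (5 + 5) → Bool) → ℤ, (∀ x, W (fun y => signOf (g y)) x = (2 : ℝ) ^ 4 * (u x : ℝ)) ∧
        IsDegLeFun 1 (fun x => decide (Odd (u x))) ∧ (∃ x, Odd (u x)) ∧ (∃ x, ¬ Odd (u x))) ∧
      (∃ v : (Fin (5 + 5) → Bool) → ℤ, (∀ y, W (fun x => signOf (f x)) y = (2 : ℝ) ^ 4 * (v y : ℝ)) ∧
        IsDegLeFun 1 (fun y => decide (Odd (v y))) ∧ (∃ y, Odd (v y)) ∧ (∃ y, ¬ Odd (v y))) := by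
  intro f g hf hg hΦ hΦ1
  refine ⟨split_ten f g hf hg hΦ hΦ1, ?_⟩
  rw [forrelation_comm] at hΦ hΦ1
  exact split_ten g f hg hf hΦ hΦ1

end Summit.QuantumAdvantage.QuantumAdvantage.Theorems.CubicForrelation.NearExactIsExact

end
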